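import Mathlib
import HarnessLib
import Summits.Ventures.LatticeQCDFlow.Exactness.SU2FTHMCTranslationCovariance
import Summits.Ventures.LatticeQCDFlow.Exactness.SU2FTHMCOmf2Covariance

/-!
# The `SU(2)` FT-HMC kernel with the OMF2 integrator commutes with LATTICE TRANSLATIONS

HONEST FRAMING: exact (Metropolis-corrected) sampling algorithms for lattice gauge theory;
figures of merit are autocorrelation/cost numbers at stated couplings and volumes; no
continuum-physics claim.

Venture `LatticeQCDFlow` (cell pub-lqcd), topic `Exactness`; FANOUT row 14 (`eng-flowhmc`, engine
`latflow.fthmc` on the `SU(2)` rung, integrator menu leapfrog / OMF2 / OMF4).  NEW WORK of the cell;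
nothing is cited as a fact; no number.  The translation twin of `SU2FTHMCOmf2Covariance` (GEN-10): the momentum re-indexing `R_a` of `SU2FTHMCTranslationCovariance` (a coordinate permutation: additive, odd, Lebesgue- and kinetic-energy preserving, commuting with the drift definitionally) fed to `FTHMCWordCovariance.gauge_fthmc_omf2_conjKernel_eq_self`:

* **`su2_fthmc_omf2_conjKernel_translate`** — for every translation `a`, member `F` with `F(V·a) = (F V)·a`, booked density and action with `J(V·a) = J V`, `S(V·a) = S V` (measurable), any drift constant `c`, trajectory length `n`, and BOTH force routines translation covariant (`g(V·a) = (g V)·a`): `conjKernel K Θ_a = K` for the OMF2 kernel.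

NOT CLAIMED: translation-equivariance of particular members beyond `SU2WilsonFlowLOTranslation`
(mask-preserving translations); floating point; `SU(N ≥ 3)`; any number.
-/

noncomputable section

namespace Summit.Ventures.LatticeQCDFlow.Exactness

open WithLp Set MeasureTheory
open ProbabilityTheory ProbabilityTheory.Kernel
open Literature.MathematicalPhysics.QuantumFieldTheory
open scoped ENNReal Matrix

variable {d L : ℕ} [NeZero L]

/-- **The `SU(2)` FT-HMC kernel with the OMF2 integrator commutes with every lattice translation**
(translation-equivariant member, translation-invariant measurable `J` and `S`, every force routine
translation covariant; any drift constants and trajectory length). -/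
theorem su2_fthmc_omf2_conjKernel_translate (a : Site d L)
    (F : GaugeConfig d L (Matrix.specialUnitaryGroup (Fin 2) ℂ) ≃ᵐ GaugeConfig d L (Matrix.specialUnitaryGroup (Fin 2) ℂ)) (hF : ∀ V : GaugeConfig d L (Matrix.specialUnitaryGroup (Fin 2) ℂ), F (fun e : Edge d L => V (e.1 + a, e.2)) = (fun e : Edge d L => (F V) (e.1 + a, e.2)))
    {J : GaugeConfig d L (Matrix.specialUnitaryGroup (Fin 2) ℂ) → ℝ} (hJm : Measurable J) (hJ : ∀ V : GaugeConfig d L (Matrix.specialUnitaryGroup (Fin 2) ℂ), J (fun e : Edge d L => V (e.1 + a, e.2)) = J V)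
    {S : GaugeConfig d L (Matrix.specialUnitaryGroup (Fin 2) ℂ) → ℝ} (hS : Measurable S) (hSi : ∀ V : GaugeConfig d L (Matrix.specialUnitaryGroup (Fin 2) ℂ), S (fun e : Edge d L => V (e.1 + a, e.2)) = S V) (c : ℝ)
    {g₁ g₂ : GaugeConfig d L (Matrix.specialUnitaryGroup (Fin 2) ℂ) → ((Edge d L × Fin 3) → ℝ)} (hg₁ : Measurable g₁) (hg₂ : Measurable g₂)
    (hgc₁ : ∀ V : GaugeConfig d L (Matrix.specialUnitaryGroup (Fin 2) ℂ), g₁ (fun e : Edge d L => V (e.1 + a, e.2)) = (fun q : Edge d L × Fin 3 => (g₁ V) ((q.1.1 + a, q.1.2), q.2)))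
    (hgc₂ : ∀ V : GaugeConfig d L (Matrix.specialUnitaryGroup (Fin 2) ℂ), g₂ (fun e : Edge d L => V (e.1 + a, e.2)) = (fun q : Edge d L × Fin 3 => (g₂ V) ((q.1.1 + a, q.1.2), q.2))) (n : ℕ) :
    conjKernel
      (conjKernel
        (refreshUpdate
          (involMH
            (⇑((flip : Equiv.Perm (GaugeConfig d L (Matrix.specialUnitaryGroup (Fin 2) ℂ) × ((Edge d L × Fin 3) → ℝ))) *
                omf2Word g₁ (mulDrift fun q : ((Edge d L × Fin 3) → ℝ) =>
                    fun ℓ : Edge d L => gaussUnit (toLp 2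
          ![Real.cos (c * Real.sqrt (q (ℓ, 0) ^ 2 + q (ℓ, 1) ^ 2 + q (ℓ, 2) ^ 2)),
            c * Real.sinc (c * Real.sqrt (q (ℓ, 0) ^ 2 + q (ℓ, 1) ^ 2 + q (ℓ, 2) ^ 2)) * q (ℓ, 0),
            c * Real.sinc (c * Real.sqrt (q (ℓ, 0) ^ 2 + q (ℓ, 1) ^ 2 + q (ℓ, 2) ^ 2)) * q (ℓ, 1),
            c * Real.sinc (c * Real.sqrt (q (ℓ, 0) ^ 2 + q (ℓ, 1) ^ 2 + q (ℓ, 2) ^ 2)) * q (ℓ, 2)])) g₂ ^ n))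
            (measurable_flip_omf2Word_pow (measurable_su2Drift c) hg₁ hg₂ n)
            fun z : GaugeConfig d L (Matrix.specialUnitaryGroup (Fin 2) ℂ) × ((Edge d L × Fin 3) → ℝ) => (S (F z.1) - Real.log (J z.1)) + ∑ i, z.2 i ^ 2 / 2)
          ((((volume : Measure ((Edge d L × Fin 3) → ℝ)).withDensity
                  fun p => ENNReal.ofReal (Real.exp (-(∑ i, p i ^ 2 / 2)))) Set.univ)⁻¹ •
              (volume : Measure ((Edge d L × Fin 3) → ℝ)).withDensity
                fun p => ENNReal.ofReal (Real.exp (-(∑ i, p i ^ 2 / 2)))))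
        F)
      ({ toFun := fun V : GaugeConfig d L (Matrix.specialUnitaryGroup (Fin 2) ℂ) => (fun e : Edge d L => V (e.1 + a, e.2)),
         invFun := fun V : GaugeConfig d L (Matrix.specialUnitaryGroup (Fin 2) ℂ) => (fun e : Edge d L => V (e.1 - a, e.2)),
         left_inv := fun V => funext fun e => by simp only [sub_add_cancel],
         right_inv := fun V => funext fun e => by simp only [add_sub_cancel_right],
         measurable_toFun := measurable_pi_lambda _ fun e => measurable_pi_apply _,
         measurable_invFun := measurable_pi_lambda _ fun e => measurable_pi_apply _ } : GaugeConfig d L (Matrix.specialUnitaryGroup (Fin 2) ℂ) ≃ᵐ GaugeConfig d L (Matrix.specialUnitaryGroup (Fin 2) ℂ)) =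
      (conjKernel
        (refreshUpdate
          (involMH
            (⇑((flip : Equiv.Perm (GaugeConfig d L (Matrix.specialUnitaryGroup (Fin 2) ℂ) × ((Edge d L × Fin 3) → ℝ))) *
                omf2Word g₁ (mulDrift fun q : ((Edge d L × Fin 3) → ℝ) =>
                    fun ℓ : Edge d L => gaussUnit (toLp 2
          ![Real.cos (c * Real.sqrt (q (ℓ, 0) ^ 2 + q (ℓ, 1) ^ 2 + q (ℓ, 2) ^ 2)),
            c * Real.sinc (c * Real.sqrt (q (ℓ, 0) ^ 2 + q (ℓ, 1) ^ 2 + q (ℓ, 2) ^ 2)) * q (ℓ, 0),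
            c * Real.sinc (c * Real.sqrt (q (ℓ, 0) ^ 2 + q (ℓ, 1) ^ 2 + q (ℓ, 2) ^ 2)) * q (ℓ, 1),
            c * Real.sinc (c * Real.sqrt (q (ℓ, 0) ^ 2 + q (ℓ, 1) ^ 2 + q (ℓ, 2) ^ 2)) * q (ℓ, 2)])) g₂ ^ n))
            (measurable_flip_omf2Word_pow (measurable_su2Drift c) hg₁ hg₂ n)
            fun z : GaugeConfig d L (Matrix.specialUnitaryGroup (Fin 2) ℂ) × ((Edge d L × Fin 3) → ℝ) => (S (F z.1) - Real.log (J z.1)) + ∑ i, z.2 i ^ 2 / 2)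
          ((((volume : Measure ((Edge d L × Fin 3) → ℝ)).withDensity
                  fun p => ENNReal.ofReal (Real.exp (-(∑ i, p i ^ 2 / 2)))) Set.univ)⁻¹ •
              (volume : Measure ((Edge d L × Fin 3) → ℝ)).withDensity
                fun p => ENNReal.ofReal (Real.exp (-(∑ i, p i ^ 2 / 2)))))
        F) := by
  let σ : (Edge d L × Fin 3) ≃ (Edge d L × Fin 3) := (Equiv.prodCongr (Equiv.prodCongr (Equiv.addRight a) (Equiv.refl (Fin d))) (Equiv.refl (Fin 3)))
  let R : ((Edge d L × Fin 3) → ℝ) ≃ᵐ ((Edge d L × Fin 3) → ℝ) := MeasurableEquiv.piCongrLeft (fun _ : Edge d L × Fin 3 => ℝ) σ.symm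
  have hRapply : ∀ p : ((Edge d L × Fin 3) → ℝ), R p = (fun q : Edge d L × Fin 3 => p ((q.1.1 + a, q.1.2), q.2)) := by
    intro p
    funext q
    change (Equiv.piCongrLeft (fun _ : Edge d L × Fin 3 => ℝ) σ.symm) p q = _
    rw [Equiv.piCongrLeft_apply_eq_cast, cast_eq]
    rfl
  have hRneg : ∀ p, R (-p) = -R p := fun p => by
    rw [hRapply, hRapply]
    rfl
  have hRadd : ∀ p p', R (p + p') = R p + R p' := fun p p' => by
    rw [hRapply, hRapply, hRapply]
    rfl
  have he : ∀ (c' : ℝ) (p : ((Edge d L × Fin 3) → ℝ)) (V : GaugeConfig d L (Matrix.specialUnitaryGroup (Fin 2) ℂ)),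
      (fun q : ((Edge d L × Fin 3) → ℝ) =>
                    fun ℓ : Edge d L => gaussUnit (toLp 2
          ![Real.cos (c' * Real.sqrt (q (ℓ, 0) ^ 2 + q (ℓ, 1) ^ 2 + q (ℓ, 2) ^ 2)),
            c' * Real.sinc (c' * Real.sqrt (q (ℓ, 0) ^ 2 + q (ℓ, 1) ^ 2 + q (ℓ, 2) ^ 2)) * q (ℓ, 0),
            c' * Real.sinc (c' * Real.sqrt (q (ℓ, 0) ^ 2 + q (ℓ, 1) ^ 2 + q (ℓ, 2) ^ 2)) * q (ℓ, 1),
            c' * Real.sinc (c' * Real.sqrt (q (ℓ, 0) ^ 2 + q (ℓ, 1) ^ 2 + q (ℓ, 2) ^ 2)) * q (ℓ, 2)])) (R p) *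
      ({ toFun := fun V : GaugeConfig d L (Matrix.specialUnitaryGroup (Fin 2) ℂ) => (fun e : Edge d L => V (e.1 + a, e.2)),
         invFun := fun V : GaugeConfig d L (Matrix.specialUnitaryGroup (Fin 2) ℂ) => (fun e : Edge d L => V (e.1 - a, e.2)),
         left_inv := fun V => funext fun e => by simp only [sub_add_cancel],
         right_inv := fun V => funext fun e => by simp only [add_sub_cancel_right],
         measurable_toFun := measurable_pi_lambda _ fun e => measurable_pi_apply _,
         measurable_invFun := measurable_pi_lambda _ fun e => measurable_pi_apply _ } : GaugeConfig d L (Matrix.specialUnitaryGroup (Fin 2) ℂ) ≃ᵐ GaugeConfig d L (Matrix.specialUnitaryGroup (Fin 2) ℂ)) V =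
      ({ toFun := fun V : GaugeConfig d L (Matrix.specialUnitaryGroup (Fin 2) ℂ) => (fun e : Edge d L => V (e.1 + a, e.2)),
         invFun := fun V : GaugeConfig d L (Matrix.specialUnitaryGroup (Fin 2) ℂ) => (fun e : Edge d L => V (e.1 - a, e.2)),
         left_inv := fun V => funext fun e => by simp only [sub_add_cancel],
         right_inv := fun V => funext fun e => by simp only [add_sub_cancel_right],
         measurable_toFun := measurable_pi_lambda _ fun e => measurable_pi_apply _,
         measurable_invFun := measurable_pi_lambda _ fun e => measurable_pi_apply _ } : GaugeConfig d L (Matrix.specialUnitaryGroup (Fin 2) ℂ) ≃ᵐ GaugeConfig d L (Matrix.specialUnitaryGroup (Fin 2) ℂ)) ((fun q : ((Edge d L × Fin 3) → ℝ) =>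
                    fun ℓ : Edge d L => gaussUnit (toLp 2
          ![Real.cos (c' * Real.sqrt (q (ℓ, 0) ^ 2 + q (ℓ, 1) ^ 2 + q (ℓ, 2) ^ 2)),
            c' * Real.sinc (c' * Real.sqrt (q (ℓ, 0) ^ 2 + q (ℓ, 1) ^ 2 + q (ℓ, 2) ^ 2)) * q (ℓ, 0),
            c' * Real.sinc (c' * Real.sqrt (q (ℓ, 0) ^ 2 + q (ℓ, 1) ^ 2 + q (ℓ, 2) ^ 2)) * q (ℓ, 1),
            c' * Real.sinc (c' * Real.sqrt (q (ℓ, 0) ^ 2 + q (ℓ, 1) ^ 2 + q (ℓ, 2) ^ 2)) * q (ℓ, 2)])) p * V) := fun c' p V => by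
    rw [hRapply]
    rfl
  have hFΘ : ∀ V : GaugeConfig d L (Matrix.specialUnitaryGroup (Fin 2) ℂ), F (
      ({ toFun := fun V : GaugeConfig d L (Matrix.specialUnitaryGroup (Fin 2) ℂ) => (fun e : Edge d L => V (e.1 + a, e.2)),
         invFun := fun V : GaugeConfig d L (Matrix.specialUnitaryGroup (Fin 2) ℂ) => (fun e : Edge d L => V (e.1 - a, e.2)),
         left_inv := fun V => funext fun e => by simp only [sub_add_cancel],
         right_inv := fun V => funext fun e => by simp only [add_sub_cancel_right],
         measurable_toFun := measurable_pi_lambda _ fun e => measurable_pi_apply _,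
         measurable_invFun := measurable_pi_lambda _ fun e => measurable_pi_apply _ } : GaugeConfig d L (Matrix.specialUnitaryGroup (Fin 2) ℂ) ≃ᵐ GaugeConfig d L (Matrix.specialUnitaryGroup (Fin 2) ℂ)) V) =
      ({ toFun := fun V : GaugeConfig d L (Matrix.specialUnitaryGroup (Fin 2) ℂ) => (fun e : Edge d L => V (e.1 + a, e.2)),
         invFun := fun V : GaugeConfig d L (Matrix.specialUnitaryGroup (Fin 2) ℂ) => (fun e : Edge d L => V (e.1 - a, e.2)),
         left_inv := fun V => funext fun e => by simp only [sub_add_cancel],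
         right_inv := fun V => funext fun e => by simp only [add_sub_cancel_right],
         measurable_toFun := measurable_pi_lambda _ fun e => measurable_pi_apply _,
         measurable_invFun := measurable_pi_lambda _ fun e => measurable_pi_apply _ } : GaugeConfig d L (Matrix.specialUnitaryGroup (Fin 2) ℂ) ≃ᵐ GaugeConfig d L (Matrix.specialUnitaryGroup (Fin 2) ℂ)) (F V) :=
    fun V => hF V
  have hSΘ : ∀ V : GaugeConfig d L (Matrix.specialUnitaryGroup (Fin 2) ℂ), S (
      ({ toFun := fun V : GaugeConfig d L (Matrix.specialUnitaryGroup (Fin 2) ℂ) => (fun e : Edge d L => V (e.1 + a, e.2)),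
         invFun := fun V : GaugeConfig d L (Matrix.specialUnitaryGroup (Fin 2) ℂ) => (fun e : Edge d L => V (e.1 - a, e.2)),
         left_inv := fun V => funext fun e => by simp only [sub_add_cancel],
         right_inv := fun V => funext fun e => by simp only [add_sub_cancel_right],
         measurable_toFun := measurable_pi_lambda _ fun e => measurable_pi_apply _,
         measurable_invFun := measurable_pi_lambda _ fun e => measurable_pi_apply _ } : GaugeConfig d L (Matrix.specialUnitaryGroup (Fin 2) ℂ) ≃ᵐ GaugeConfig d L (Matrix.specialUnitaryGroup (Fin 2) ℂ)) V) = S V := fun V => hSi V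
  have hJΘ : ∀ V : GaugeConfig d L (Matrix.specialUnitaryGroup (Fin 2) ℂ), J (
      ({ toFun := fun V : GaugeConfig d L (Matrix.specialUnitaryGroup (Fin 2) ℂ) => (fun e : Edge d L => V (e.1 + a, e.2)),
         invFun := fun V : GaugeConfig d L (Matrix.specialUnitaryGroup (Fin 2) ℂ) => (fun e : Edge d L => V (e.1 - a, e.2)),
         left_inv := fun V => funext fun e => by simp only [sub_add_cancel],
         right_inv := fun V => funext fun e => by simp only [add_sub_cancel_right],
         measurable_toFun := measurable_pi_lambda _ fun e => measurable_pi_apply _,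
         measurable_invFun := measurable_pi_lambda _ fun e => measurable_pi_apply _ } : GaugeConfig d L (Matrix.specialUnitaryGroup (Fin 2) ℂ) ≃ᵐ GaugeConfig d L (Matrix.specialUnitaryGroup (Fin 2) ℂ)) V) = J V := fun V => hJ V
  have hTR : ∀ p : ((Edge d L × Fin 3) → ℝ), (fun p : ((Edge d L × Fin 3) → ℝ) => ∑ i, p i ^ 2 / 2) (R p) = (fun p : ((Edge d L × Fin 3) → ℝ) => ∑ i, p i ^ 2 / 2) p := by
    intro p
    change ∑ i, (R p) i ^ 2 / 2 = ∑ i, p i ^ 2 / 2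
    rw [hRapply]
    exact Fintype.sum_equiv σ _ _ (fun q => rfl)
  have hRν : MeasurePreserving R (volume : Measure ((Edge d L × Fin 3) → ℝ)) volume :=
    volume_measurePreserving_piCongrLeft (fun _ : Edge d L × Fin 3 => ℝ) σ.symm
  have hg₁Θ : ∀ V : GaugeConfig d L (Matrix.specialUnitaryGroup (Fin 2) ℂ), g₁ (
      ({ toFun := fun V : GaugeConfig d L (Matrix.specialUnitaryGroup (Fin 2) ℂ) => (fun e : Edge d L => V (e.1 + a, e.2)),
         invFun := fun V : GaugeConfig d L (Matrix.specialUnitaryGroup (Fin 2) ℂ) => (fun e : Edge d L => V (e.1 - a, e.2)),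
         left_inv := fun V => funext fun e => by simp only [sub_add_cancel],
         right_inv := fun V => funext fun e => by simp only [add_sub_cancel_right],
         measurable_toFun := measurable_pi_lambda _ fun e => measurable_pi_apply _,
         measurable_invFun := measurable_pi_lambda _ fun e => measurable_pi_apply _ } : GaugeConfig d L (Matrix.specialUnitaryGroup (Fin 2) ℂ) ≃ᵐ GaugeConfig d L (Matrix.specialUnitaryGroup (Fin 2) ℂ)) V) = R (g₁ V) := fun V => by
    rw [hRapply]
    exact hgc₁ V
  have hg₂Θ : ∀ V : GaugeConfig d L (Matrix.specialUnitaryGroup (Fin 2) ℂ), g₂ (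
      ({ toFun := fun V : GaugeConfig d L (Matrix.specialUnitaryGroup (Fin 2) ℂ) => (fun e : Edge d L => V (e.1 + a, e.2)),
         invFun := fun V : GaugeConfig d L (Matrix.specialUnitaryGroup (Fin 2) ℂ) => (fun e : Edge d L => V (e.1 - a, e.2)),
         left_inv := fun V => funext fun e => by simp only [sub_add_cancel],
         right_inv := fun V => funext fun e => by simp only [add_sub_cancel_right],
         measurable_toFun := measurable_pi_lambda _ fun e => measurable_pi_apply _,
         measurable_invFun := measurable_pi_lambda _ fun e => measurable_pi_apply _ } : GaugeConfig d L (Matrix.specialUnitaryGroup (Fin 2) ℂ) ≃ᵐ GaugeConfig d L (Matrix.specialUnitaryGroup (Fin 2) ℂ)) V) = R (g₂ V) := fun V => by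
    rw [hRapply]
    exact hgc₂ V
  exact gauge_fthmc_omf2_conjKernel_eq_self (Q := GaugeConfig d L (Matrix.specialUnitaryGroup (Fin 2) ℂ)) (P := ((Edge d L × Fin 3) → ℝ)) (ν := (volume : Measure ((Edge d L × Fin 3) → ℝ)))
    (e := (fun q : ((Edge d L × Fin 3) → ℝ) =>
                    fun ℓ : Edge d L => gaussUnit (toLp 2
          ![Real.cos (c * Real.sqrt (q (ℓ, 0) ^ 2 + q (ℓ, 1) ^ 2 + q (ℓ, 2) ^ 2)),
            c * Real.sinc (c * Real.sqrt (q (ℓ, 0) ^ 2 + q (ℓ, 1) ^ 2 + q (ℓ, 2) ^ 2)) * q (ℓ, 0),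
            c * Real.sinc (c * Real.sqrt (q (ℓ, 0) ^ 2 + q (ℓ, 1) ^ 2 + q (ℓ, 2) ^ 2)) * q (ℓ, 1),
            c * Real.sinc (c * Real.sqrt (q (ℓ, 0) ^ 2 + q (ℓ, 1) ^ 2 + q (ℓ, 2) ^ 2)) * q (ℓ, 2)])))
    (g₁ := g₁) (g₂ := g₂) (S := S) (T := fun p : ((Edge d L × Fin 3) → ℝ) => ∑ i, p i ^ 2 / 2) (J := J) n
    hS measurable_piGaussianKinetic F hJm
    ({ toFun := fun V : GaugeConfig d L (Matrix.specialUnitaryGroup (Fin 2) ℂ) => (fun e : Edge d L => V (e.1 + a, e.2)),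
         invFun := fun V : GaugeConfig d L (Matrix.specialUnitaryGroup (Fin 2) ℂ) => (fun e : Edge d L => V (e.1 - a, e.2)),
         left_inv := fun V => funext fun e => by simp only [sub_add_cancel],
         right_inv := fun V => funext fun e => by simp only [add_sub_cancel_right],
         measurable_toFun := measurable_pi_lambda _ fun e => measurable_pi_apply _,
         measurable_invFun := measurable_pi_lambda _ fun e => measurable_pi_apply _ } : GaugeConfig d L (Matrix.specialUnitaryGroup (Fin 2) ℂ) ≃ᵐ GaugeConfig d L (Matrix.specialUnitaryGroup (Fin 2) ℂ)) R hRneg hRadd (he c)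
    hg₁Θ hg₂Θ hFΘ hSΘ hJΘ hTR hRν

end Summit.Ventures.LatticeQCDFlow.Exactness
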